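import Summits.HodgeConjecture.HodgeConjecture.Theorems.NikulinTwinTransportTwinSimilitudeAlgebraicLattice

/-!
# Route NikulinTwinTransport · crux `HodgeSimilitudeAlgebraic` (stmt-HodgeConjecture-13676) —
# rational `n`-similitudes of the K3 lattice for EVERY positive integer `n`

A twin transport at multiplier `n` (route text: "one anchor per prime … each transported as in
TwinTwistorTransport") starts from ONE `ℂ`-linear `n`-similitude `M` of `(Λ_ℂ, k3Form)` defined
over `ℚ` with an inverse over `ℚ` (hypotheses `M, N, hNrat, hMN, hM2` of
`twinSimilitudeAlgebraic_of_twinTransport`, there `n = 2`, discharged by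
`exists_twoSimilitude_k3Lattice`). `exists_ratSimilitude_k3Lattice` supplies such an `M` for EVERY
`n ≥ 1` (`Λ_ℚ(n) ≅ Λ_ℚ`): `n`-twins of projective K3 periods exist for all `n`, and the
twin-transport form of the crux makes sense prime by prime.
Construction (`Λ = E₈(−1)^{⊕2} ⊕ U^{⊕3}`): `n = a² + b² + c² + d²` (Lagrange); Bourbaki's simple
roots give `P` with `Pᵀ P = E₈` (Mathlib's `CartanMatrix.E₈`), and on `ℚ⁸ = ℍ_ℚ ⊕ ℍ_ℚ` left
multiplication `L_x` by `x = a + bi + cj + dk` has `L_xᵀ L_x = N(x) = n` (Euler), so `P⁻¹ L_x P` is a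
rational `n`-similitude of `E₈(−1) ⊗ ℚ`; on each hyperbolic plane `diag(1, n)`-type matrices. To
stay with integer matrices and `decide`, the file uses `2P` (`PE2`), `4(2P)⁻¹` (`PEinv2`) and the
integer quaternion units `QI, QJ, QK` (identities by `decide` over `ℤ`, then mapped to `ℚ`), builds
the rational `16n`-similitude `AA` with quasi-inverse `BB` (`AA·BB = 16n`), and takes `M = ¼ AA`,
`N = (4n)⁻¹ BB` over `ℂ`. Block algebra from `NikulinTwinTransportTwinSimilitudeAlgebraicLattice`.
-/

noncomputable section

open scoped Matrix
open Literature.AlgebraicGeometry.Surfaces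

namespace Summit.HodgeConjecture.HodgeConjecture.Theorems.NikulinTwinTransport

/-! ### Integer data: quaternion units on `ℤ⁴ ⊕ ℤ⁴` and the `E₈` root coordinates (all `decide`) -/

/-- Left multiplication by the quaternion `i` on `ℍ ⊕ ℍ = ℤ⁸` (basis `1, i, j, k` twice).
Local notation only. -/
local notation3 (prettyPrint := false) "QI" => (!![(0:ℤ), -1, 0, 0, 0, 0, 0, 0;
    1, 0, 0, 0, 0, 0, 0, 0; 0, 0, 0, -1, 0, 0, 0, 0;
    0, 0, 1, 0, 0, 0, 0, 0; 0, 0, 0, 0, 0, -1, 0, 0;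
    0, 0, 0, 0, 1, 0, 0, 0; 0, 0, 0, 0, 0, 0, 0, -1;
    0, 0, 0, 0, 0, 0, 1, 0] : Matrix (Fin 8) (Fin 8) ℤ)

/-- Left multiplication by the quaternion `j` on `ℍ ⊕ ℍ = ℤ⁸`. Local notation only. -/
local notation3 (prettyPrint := false) "QJ" => (!![(0:ℤ), 0, -1, 0, 0, 0, 0, 0;
    0, 0, 0, 1, 0, 0, 0, 0; 1, 0, 0, 0, 0, 0, 0, 0;
    0, -1, 0, 0, 0, 0, 0, 0; 0, 0, 0, 0, 0, 0, -1, 0;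
    0, 0, 0, 0, 0, 0, 0, 1; 0, 0, 0, 0, 1, 0, 0, 0;
    0, 0, 0, 0, 0, -1, 0, 0] : Matrix (Fin 8) (Fin 8) ℤ)

/-- Left multiplication by the quaternion `k = ij` on `ℍ ⊕ ℍ = ℤ⁸`. Local notation only. -/
local notation3 (prettyPrint := false) "QK" => (!![(0:ℤ), 0, 0, -1, 0, 0, 0, 0;
    0, 0, -1, 0, 0, 0, 0, 0; 0, 1, 0, 0, 0, 0, 0, 0;
    1, 0, 0, 0, 0, 0, 0, 0; 0, 0, 0, 0, 0, 0, 0, -1;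
    0, 0, 0, 0, 0, 0, -1, 0; 0, 0, 0, 0, 0, 1, 0, 0;
    0, 0, 0, 0, 1, 0, 0, 0] : Matrix (Fin 8) (Fin 8) ℤ)

/-- Twice the matrix whose columns are Bourbaki's simple roots `α₁, …, α₈` of `E₈` in the standard
coordinates of `ℝ⁸` (`α₁ = ½(e₁+e₈) − ½(e₂+⋯+e₇)`, `α₂ = e₁+e₂`, `α₃ = e₂−e₁`, …, `α₈ = e₇−e₆`):
`(2P)ᵀ (2P) = 4 E₈` for Mathlib's `CartanMatrix.E₈`. Local notation only. -/
local notation3 (prettyPrint := false) "PE2" => (!![(1 : ℤ), 2, -2, 0, 0, 0, 0, 0;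
    -1, 2, 2, -2, 0, 0, 0, 0; -1, 0, 0, 2, -2, 0, 0, 0;
    -1, 0, 0, 0, 2, -2, 0, 0; -1, 0, 0, 0, 0, 2, -2, 0;
    -1, 0, 0, 0, 0, 0, 2, -2; -1, 0, 0, 0, 0, 0, 0, 2;
    1, 0, 0, 0, 0, 0, 0, 0] : Matrix (Fin 8) (Fin 8) ℤ)

/-- `4 (2P)⁻¹`, an integer matrix: `(2P) · PEinv2 = 4 = PEinv2 · (2P)`. Local notation only. -/
local notation3 (prettyPrint := false) "PEinv2" => (!![(0 : ℤ), 0, 0, 0, 0, 0, 0, 4;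
    1, 1, 1, 1, 1, 1, 1, 5; -1, 1, 1, 1, 1, 1, 1, 7;
    0, 0, 2, 2, 2, 2, 2, 10; 0, 0, 0, 2, 2, 2, 2, 8;
    0, 0, 0, 0, 2, 2, 2, 6; 0, 0, 0, 0, 0, 2, 2, 4;
    0, 0, 0, 0, 0, 0, 2, 2] : Matrix (Fin 8) (Fin 8) ℤ)

/-- The cast `ℤ → ℚ` as a ring homomorphism (so that `Matrix.map_mul` applies). Local notation only. -/
local notation3 (prettyPrint := false) "ιQ" => (Int.castRingHom ℚ : ℤ →+* ℚ)

/-- `i² = −1` on `ℤ⁸`. [folklore] -/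
theorem qi_mul_qi : QI * QI = -1 := by decide
/-- `j² = −1`. [folklore] -/
theorem qj_mul_qj : QJ * QJ = -1 := by decide
/-- `k² = −1`. [folklore] -/
theorem qk_mul_qk : QK * QK = -1 := by decide
/-- `ij = k`. [folklore] -/
theorem qi_mul_qj : QI * QJ = QK := by decide
/-- `ji = −k`. [folklore] -/
theorem qj_mul_qi : QJ * QI = -QK := by decide
/-- `jk = i`. [folklore] -/
theorem qj_mul_qk : QJ * QK = QI := by decide
/-- `kj = −i`. [folklore] -/
theorem qk_mul_qj : QK * QJ = -QI := by decide
/-- `ki = j`. [folklore] -/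
theorem qk_mul_qi : QK * QI = QJ := by decide
/-- `ik = −j`. [folklore] -/
theorem qi_mul_qk : QI * QK = -QJ := by decide
/-- `L_i` is skew. [folklore] -/
theorem qi_transpose : (QI)ᵀ = -QI := by decide
/-- `L_j` is skew. [folklore] -/
theorem qj_transpose : (QJ)ᵀ = -QJ := by decide
/-- `L_k` is skew. [folklore] -/
theorem qk_transpose : (QK)ᵀ = -QK := by decide
/-- `(2P)ᵀ (2P) = 4 E₈`: Bourbaki's simple roots realise Mathlib's Cartan matrix of `E₈`.
[cite: ConwaySloane1999, Ch. 4 §8.1 (coordinates for E₈)] -/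
theorem pe2_transpose_mul_pe2 :
    (PE2)ᵀ * PE2 = CartanMatrix.E₈ + CartanMatrix.E₈ + CartanMatrix.E₈ + CartanMatrix.E₈ := by decide
/-- `(2P) · PEinv2 = 4`. [folklore] -/
theorem pe2_mul_peinv2 : PE2 * PEinv2 = 1 + 1 + 1 + 1 := by decide
/-- `PEinv2 · (2P) = 4`. [folklore] -/
theorem peinv2_mul_pe2 : PEinv2 * PE2 = 1 + 1 + 1 + 1 := by decide

/-! ### The same identities over `ℚ` -/
/-- `L_i ⊗ ℚ`. Local notation only. -/
local notation3 (prettyPrint := false) "Iq" => ((QI).map ιQ : Matrix (Fin 8) (Fin 8) ℚ)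
/-- `L_j ⊗ ℚ`. Local notation only. -/
local notation3 (prettyPrint := false) "Jq" => ((QJ).map ιQ : Matrix (Fin 8) (Fin 8) ℚ)
/-- `L_k ⊗ ℚ`. Local notation only. -/
local notation3 (prettyPrint := false) "Kq" => ((QK).map ιQ : Matrix (Fin 8) (Fin 8) ℚ)
/-- `2P ⊗ ℚ`. Local notation only. -/
local notation3 (prettyPrint := false) "Pq" => ((PE2).map ιQ : Matrix (Fin 8) (Fin 8) ℚ)
/-- `4(2P)⁻¹ ⊗ ℚ`. Local notation only. -/
local notation3 (prettyPrint := false) "Piq" => ((PEinv2).map ιQ : Matrix (Fin 8) (Fin 8) ℚ)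
/-- `E₈ ⊗ ℚ` (as in `k3Gram_map_ratCast`). Local notation only. -/
local notation3 (prettyPrint := false) "E8q" => ((CartanMatrix.E₈).map (Int.cast : ℤ → ℚ) : Matrix (Fin 8) (Fin 8) ℚ)

/-- `ℤ → ℚ` commutes with negation of matrices. [folklore] -/
private theorem map_neg_ιQ (A : Matrix (Fin 8) (Fin 8) ℤ) : (-A).map ιQ = -A.map ιQ :=
  Matrix.map_neg _ (map_neg ιQ) A

/-- `ℤ → ℚ` maps the identity matrix to the identity matrix. [folklore] -/
private theorem map_one_ιQ : (1 : Matrix (Fin 8) (Fin 8) ℤ).map ιQ = 1 :=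
  Matrix.map_one _ (map_zero ιQ) (map_one ιQ)

/-- `i² = −1` over `ℚ`. [folklore] -/
theorem iq_mul_iq : Iq * Iq = -1 := by rw [← Matrix.map_mul, qi_mul_qi, map_neg_ιQ, map_one_ιQ]
/-- `j² = −1` over `ℚ`. [folklore] -/
theorem jq_mul_jq : Jq * Jq = -1 := by rw [← Matrix.map_mul, qj_mul_qj, map_neg_ιQ, map_one_ιQ]
/-- `k² = −1` over `ℚ`. [folklore] -/
theorem kq_mul_kq : Kq * Kq = -1 := by rw [← Matrix.map_mul, qk_mul_qk, map_neg_ιQ, map_one_ιQ]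
/-- `ij = k` over `ℚ`. [folklore] -/
theorem iq_mul_jq : Iq * Jq = Kq := by rw [← Matrix.map_mul, qi_mul_qj]
/-- `ji = −k` over `ℚ`. [folklore] -/
theorem jq_mul_iq : Jq * Iq = -Kq := by rw [← Matrix.map_mul, qj_mul_qi, map_neg_ιQ]
/-- `jk = i` over `ℚ`. [folklore] -/
theorem jq_mul_kq : Jq * Kq = Iq := by rw [← Matrix.map_mul, qj_mul_qk]
/-- `kj = −i` over `ℚ`. [folklore] -/
theorem kq_mul_jq : Kq * Jq = -Iq := by rw [← Matrix.map_mul, qk_mul_qj, map_neg_ιQ]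
/-- `ki = j` over `ℚ`. [folklore] -/
theorem kq_mul_iq : Kq * Iq = Jq := by rw [← Matrix.map_mul, qk_mul_qi]
/-- `ik = −j` over `ℚ`. [folklore] -/
theorem iq_mul_kq : Iq * Kq = -Jq := by rw [← Matrix.map_mul, qi_mul_qk, map_neg_ιQ]
/-- `L_iᵀ = −L_i` over `ℚ`. [folklore] -/
theorem iq_transpose : (Iq)ᵀ = -Iq := by rw [← Matrix.transpose_map, qi_transpose, map_neg_ιQ]
/-- `L_jᵀ = −L_j` over `ℚ`. [folklore] -/
theorem jq_transpose : (Jq)ᵀ = -Jq := by rw [← Matrix.transpose_map, qj_transpose, map_neg_ιQ]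
/-- `L_kᵀ = −L_k` over `ℚ`. [folklore] -/
theorem kq_transpose : (Kq)ᵀ = -Kq := by rw [← Matrix.transpose_map, qk_transpose, map_neg_ιQ]
/-- `(2P)ᵀ (2P) = 4 E₈` over `ℚ`. [cite: ConwaySloane1999, Ch. 4 §8.1 (coordinates for E₈)] -/
theorem pq_transpose_mul_pq : (Pq)ᵀ * Pq = (4 : ℚ) • E8q := by
  rw [← Matrix.transpose_map, ← Matrix.map_mul, pe2_transpose_mul_pe2,
    Matrix.map_add _ (map_add ιQ), Matrix.map_add _ (map_add ιQ), Matrix.map_add _ (map_add ιQ)]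
  have h : (CartanMatrix.E₈).map ιQ = E8q := rfl
  rw [h]
  module
/-- `(2P) · PEinv2 = 4` over `ℚ`. [folklore] -/
theorem pq_mul_piq : Pq * Piq = (4 : ℚ) • 1 := by
  rw [← Matrix.map_mul, pe2_mul_peinv2, Matrix.map_add _ (map_add ιQ), Matrix.map_add _ (map_add ιQ),
    Matrix.map_add _ (map_add ιQ), map_one_ιQ]
  module
/-- `PEinv2 · (2P) = 4` over `ℚ`. [folklore] -/
theorem piq_mul_pq : Piq * Pq = (4 : ℚ) • 1 := by
  rw [← Matrix.map_mul, peinv2_mul_pe2, Matrix.map_add _ (map_add ιQ), Matrix.map_add _ (map_add ιQ),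
    Matrix.map_add _ (map_add ιQ), map_one_ιQ]
  module

/-! ### Quaternion norm: `L_xᵀ L_x = N(x) = L_x L_xᵀ` for `x = a + bi + cj + dk` -/

/-- Left multiplication by the quaternion `x = a + bi + cj + dk` on `ℚ⁴ ⊕ ℚ⁴`. Local notation only. -/
local notation3 (prettyPrint := false) "Lq[" a ", " b ", " c ", " d "]" =>
  (a • (1 : Matrix (Fin 8) (Fin 8) ℚ) + b • Iq + c • Jq + d • Kq)

/-- `L_xᵀ = L_{x̄}`. [folklore] -/
theorem lq_transpose (a b c d : ℚ) :
    (Lq[a, b, c, d])ᵀ = a • (1 : Matrix (Fin 8) (Fin 8) ℚ) + (-b) • Iq + (-c) • Jq + (-d) • Kq := by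
  rw [Matrix.transpose_add, Matrix.transpose_add, Matrix.transpose_add, Matrix.transpose_smul,
    Matrix.transpose_smul, Matrix.transpose_smul, Matrix.transpose_smul, Matrix.transpose_one,
    iq_transpose, jq_transpose, kq_transpose]
  module

/-- **`L_xᵀ L_x = N(x)`**: the columns of left multiplication by a quaternion are orthogonal of
square length `a² + b² + c² + d²` (Euler's four-square identity). [folklore] -/
theorem lq_transpose_mul_lq (a b c d : ℚ) :
    (Lq[a, b, c, d])ᵀ * Lq[a, b, c, d] = (a ^ 2 + b ^ 2 + c ^ 2 + d ^ 2) • (1 : Matrix (Fin 8) (Fin 8) ℚ) := by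
  rw [lq_transpose]
  simp only [add_mul, mul_add, smul_mul_assoc, mul_smul_comm, Matrix.one_mul, Matrix.mul_one,
    iq_mul_iq, jq_mul_jq, kq_mul_kq, iq_mul_jq, jq_mul_iq, jq_mul_kq, kq_mul_jq, kq_mul_iq, iq_mul_kq,
    smul_neg]
  module

/-- **`L_x L_xᵀ = N(x)`**. [folklore] -/
theorem lq_mul_lq_transpose (a b c d : ℚ) :
    Lq[a, b, c, d] * (Lq[a, b, c, d])ᵀ = (a ^ 2 + b ^ 2 + c ^ 2 + d ^ 2) • (1 : Matrix (Fin 8) (Fin 8) ℚ) := by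
  rw [lq_transpose]
  simp only [add_mul, mul_add, smul_mul_assoc, mul_smul_comm, Matrix.one_mul, Matrix.mul_one,
    iq_mul_iq, jq_mul_jq, kq_mul_kq, iq_mul_jq, jq_mul_iq, jq_mul_kq, kq_mul_jq, kq_mul_iq, iq_mul_kq,
    smul_neg]
  module

/-! ### The `E₈`-block: `X = PEinv2 · L_x · (2P)` is a rational `16 N(x)`-similitude of `E₈ ⊗ ℚ` -/

section E8Block

variable (a b c d m : ℚ) (hm : a ^ 2 + b ^ 2 + c ^ 2 + d ^ 2 = m)
include hm

/-- `X = PEinv2 · L_x · 2P` satisfies `Xᵀ E₈ X = 16 N(x) · E₈`: in root coordinates, left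
multiplication by the quaternion `x` on `E₈ ⊗ ℚ = ℚ⁸ = ℍ_ℚ ⊕ ℍ_ℚ` (standard form) is a similitude of
multiplier `N(x)`; the factors `2P`, `4(2P)⁻¹` contribute `16`. [folklore] -/
theorem e8Block_conj :
    (Piq * Lq[a, b, c, d] * Pq)ᵀ * E8q * (Piq * Lq[a, b, c, d] * Pq) = (16 * m) • E8q := by
  have hE : E8q = (4 : ℚ)⁻¹ • ((Pq)ᵀ * Pq) := by
    rw [pq_transpose_mul_pq, smul_smul]; norm_num
  have h1 : ∀ Y : Matrix (Fin 8) (Fin 8) ℚ, Pq * (Piq * Y) = (4 : ℚ) • Y := fun Y => by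
    rw [← Matrix.mul_assoc, pq_mul_piq, smul_mul_assoc, Matrix.one_mul]
  have h2 : ∀ Y : Matrix (Fin 8) (Fin 8) ℚ, (Piq)ᵀ * ((Pq)ᵀ * Y) = (4 : ℚ) • Y := fun Y => by
    rw [← Matrix.mul_assoc, ← Matrix.transpose_mul, pq_mul_piq, Matrix.transpose_smul,
      Matrix.transpose_one, smul_mul_assoc, Matrix.one_mul]
  have h3 : ∀ Y : Matrix (Fin 8) (Fin 8) ℚ, (Lq[a, b, c, d])ᵀ * (Lq[a, b, c, d] * Y) = m • Y :=
    fun Y => by rw [← Matrix.mul_assoc, lq_transpose_mul_lq, hm, smul_mul_assoc, Matrix.one_mul]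
  rw [hE]
  simp only [Matrix.transpose_mul, Matrix.mul_assoc, Matrix.mul_smul, Matrix.smul_mul, h1, h2, h3,
    smul_smul]
  congr 1
  ring

/-- `X · X' = 16 N(x)` for `X' = PEinv2 · L_xᵀ · 2P`. [folklore] -/
theorem e8Block_mul_inv :
    (Piq * Lq[a, b, c, d] * Pq) * (Piq * (Lq[a, b, c, d])ᵀ * Pq) = (16 * m) • 1 := by
  have h1 : ∀ Y : Matrix (Fin 8) (Fin 8) ℚ, Pq * (Piq * Y) = (4 : ℚ) • Y := fun Y => by
    rw [← Matrix.mul_assoc, pq_mul_piq, smul_mul_assoc, Matrix.one_mul]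
  have h4 : ∀ Y : Matrix (Fin 8) (Fin 8) ℚ, Lq[a, b, c, d] * ((Lq[a, b, c, d])ᵀ * Y) = m • Y :=
    fun Y => by rw [← Matrix.mul_assoc, lq_mul_lq_transpose, hm, smul_mul_assoc, Matrix.one_mul]
  have h5 : Piq * Pq = (4 : ℚ) • 1 := piq_mul_pq
  simp only [Matrix.mul_assoc, Matrix.mul_smul, h1, h4, h5, smul_smul]
  congr 1
  ring

/-- `X' · X = 16 N(x)`. [folklore] -/
theorem e8Block_inv_mul :
    (Piq * (Lq[a, b, c, d])ᵀ * Pq) * (Piq * Lq[a, b, c, d] * Pq) = (16 * m) • 1 := by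
  have h1 : ∀ Y : Matrix (Fin 8) (Fin 8) ℚ, Pq * (Piq * Y) = (4 : ℚ) • Y := fun Y => by
    rw [← Matrix.mul_assoc, pq_mul_piq, smul_mul_assoc, Matrix.one_mul]
  have h3 : ∀ Y : Matrix (Fin 8) (Fin 8) ℚ, (Lq[a, b, c, d])ᵀ * (Lq[a, b, c, d] * Y) = m • Y :=
    fun Y => by rw [← Matrix.mul_assoc, lq_transpose_mul_lq, hm, smul_mul_assoc, Matrix.one_mul]
  have h5 : Piq * Pq = (4 : ℚ) • 1 := piq_mul_pq
  simp only [Matrix.mul_assoc, Matrix.mul_smul, h1, h3, h5, smul_smul]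
  congr 1
  ring

end E8Block

/-! ### The `U`-block: `diag(1, 16m)` -/
/-- The rational hyperbolic plane (as in `k3Gram_map_ratCast`). Local notation only. -/
local notation3 (prettyPrint := false) "UQ" => (hyperbolicPlaneGram.map (Int.cast : ℤ → ℚ) : Matrix (Fin 2) (Fin 2) ℚ)
/-- `diag(1, 16m)` on a hyperbolic plane (`U(16m) ⊂ U`). Local notation only. -/
local notation3 (prettyPrint := false) "DU[" m "]" => (!![(1 : ℚ), 0; 0, 16 * m] : Matrix (Fin 2) (Fin 2) ℚ)
/-- `diag(16m, 1)`, with `DU[m] · DU'[m] = 16m`. Local notation only. -/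
local notation3 (prettyPrint := false) "DU'[" m "]" => (!![16 * m, 0; 0, (1 : ℚ)] : Matrix (Fin 2) (Fin 2) ℚ)

/-- `diag(1,16m)ᵀ U diag(1,16m) = 16m · U`. [folklore] -/
theorem uBlock_conj (m : ℚ) : (DU[m])ᵀ * UQ * DU[m] = (16 * m) • UQ := by
  ext i j
  fin_cases i <;> fin_cases j <;>
    simp [Matrix.mul_apply, Fin.sum_univ_two, hyperbolicPlaneGram]

/-- `diag(1,16m) · diag(16m,1) = 16m`. [folklore] -/
theorem uBlock_mul_inv (m : ℚ) : DU[m] * DU'[m] = (16 * m) • 1 := by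
  ext i j
  fin_cases i <;> fin_cases j <;> simp [Matrix.mul_apply, Fin.sum_univ_two]

/-- `diag(16m,1) · diag(1,16m) = 16m`. [folklore] -/
theorem uBlock_inv_mul (m : ℚ) : DU'[m] * DU[m] = (16 * m) • 1 := by
  ext i j
  fin_cases i <;> fin_cases j <;> simp [Matrix.mul_apply, Fin.sum_univ_two]

/-! ### The whole lattice -/
/-- The block on `U^{⊕3} ⊗ ℚ`. Local notation only. -/
local notation3 (prettyPrint := false) "AU[" m "]" => (Matrix.fromBlocks DU[m] 0 0 (Matrix.fromBlocks DU[m] 0 0 DU[m]) :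
  Matrix (Fin 2 ⊕ (Fin 2 ⊕ Fin 2)) (Fin 2 ⊕ (Fin 2 ⊕ Fin 2)) ℚ)
/-- Its quasi-inverse (`AU · BU = 16m`). Local notation only. -/
local notation3 (prettyPrint := false) "BU[" m "]" => (Matrix.fromBlocks DU'[m] 0 0 (Matrix.fromBlocks DU'[m] 0 0 DU'[m]) :
  Matrix (Fin 2 ⊕ (Fin 2 ⊕ Fin 2)) (Fin 2 ⊕ (Fin 2 ⊕ Fin 2)) ℚ)
/-- The rational `16 N(x)`-similitude of `Λ_ℚ`. Local notation only. -/
local notation3 (prettyPrint := false) "AA[" a ", " b ", " c ", " d ", " m "]" =>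
  (Matrix.fromBlocks
    (Matrix.fromBlocks (Piq * Lq[a, b, c, d] * Pq) 0 0 (Piq * Lq[a, b, c, d] * Pq)) 0 0 AU[m] :
    Matrix K3Index K3Index ℚ)
/-- Its quasi-inverse (`AA · BB = 16 N(x)`). Local notation only. -/
local notation3 (prettyPrint := false) "BB[" a ", " b ", " c ", " d ", " m "]" =>
  (Matrix.fromBlocks
    (Matrix.fromBlocks (Piq * (Lq[a, b, c, d])ᵀ * Pq) 0 0 (Piq * (Lq[a, b, c, d])ᵀ * Pq)) 0 0 BU[m] :
    Matrix K3Index K3Index ℚ)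

/-- `c • 1 = diag(c • 1, c • 1)` in blocks. [folklore] -/
theorem smul_one_eq_fromBlocks {p q : Type*} [DecidableEq p] [DecidableEq q] (c : ℚ) :
    (c • (1 : Matrix (p ⊕ q) (p ⊕ q) ℚ)) = Matrix.fromBlocks (c • 1) 0 0 (c • 1) := by
  rw [← Matrix.fromBlocks_one, Matrix.fromBlocks_smul, smul_zero, smul_zero]

section Whole

variable (a b c d m : ℚ) (hm : a ^ 2 + b ^ 2 + c ^ 2 + d ^ 2 = m)
include hm

/-- `AA · BB = 16m`. [folklore] -/
theorem aa_mul_bb_eq : AA[a, b, c, d, m] * BB[a, b, c, d, m] = (16 * m) • 1 := by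
  rw [fromBlocks_diag_mul, fromBlocks_diag_mul, fromBlocks_diag_mul, fromBlocks_diag_mul,
    e8Block_mul_inv a b c d m hm, uBlock_mul_inv, smul_one_eq_fromBlocks, smul_one_eq_fromBlocks,
    smul_one_eq_fromBlocks, smul_one_eq_fromBlocks]

/-- `BB · AA = 16m`. [folklore] -/
theorem bb_mul_aa_eq : BB[a, b, c, d, m] * AA[a, b, c, d, m] = (16 * m) • 1 := by
  rw [fromBlocks_diag_mul, fromBlocks_diag_mul, fromBlocks_diag_mul, fromBlocks_diag_mul,
    e8Block_inv_mul a b c d m hm, uBlock_inv_mul, smul_one_eq_fromBlocks, smul_one_eq_fromBlocks,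
    smul_one_eq_fromBlocks, smul_one_eq_fromBlocks]

/-- `AAᵀ Λ_ℚ AA = 16m · Λ_ℚ`: `AA` is a rational `16m`-similitude of the K3 lattice. [folklore] -/
theorem aa_conj_eq :
    (AA[a, b, c, d, m])ᵀ * k3Gram.map (Int.cast : ℤ → ℚ) * AA[a, b, c, d, m] =
      (16 * m) • k3Gram.map (Int.cast : ℤ → ℚ) := by
  have hE : (Piq * Lq[a, b, c, d] * Pq)ᵀ * (-E8q) * (Piq * Lq[a, b, c, d] * Pq) = (16 * m) • (-E8q) := by
    rw [Matrix.mul_neg, Matrix.neg_mul, e8Block_conj a b c d m hm, smul_neg]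
  rw [k3Gram_map_ratCast, fromBlocks_diag_conj, fromBlocks_diag_conj, fromBlocks_diag_conj,
    fromBlocks_diag_conj, hE, uBlock_conj]
  simp only [Matrix.fromBlocks_smul, smul_zero]

end Whole

/-- **Rational `n`-similitudes of the K3 lattice for every positive integer `n`.** For every
`n ≥ 1` there are `ℂ`-linear `M, N : Λ_ℂ → Λ_ℂ` defined over `ℚ`, inverse to each other, with
`(Ma.Mb) = n (a.b)` for the K3 form. Construction: `n = a² + b² + c² + d²` (Lagrange); on each
`E₈(−1)`-block, left multiplication by the quaternion `a + bi + cj + dk` on `E₈ ⊗ ℚ ≅ ℚ⁸` written in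
root coordinates (`X = ¼ · PEinv2 · L_x · 2P`); on each hyperbolic plane `diag(¼, 4n)`. So
`Λ_ℚ(n) ≅ Λ_ℚ` and `n`-twins of marked K3 periods exist for every `n`. [folklore] -/
theorem exists_ratSimilitude_k3Lattice (n : ℕ) (hn : 0 < n) :
    ∃ (M N : Module.End ℂ (K3Index → ℂ)),
      (∀ v : K3Index → ℤ, ∃ w : K3Index → ℚ, M (fun i => (v i : ℂ)) = fun i => (w i : ℂ)) ∧
      (∀ v : K3Index → ℤ, ∃ w : K3Index → ℚ, N (fun i => (v i : ℂ)) = fun i => (w i : ℂ)) ∧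
      M * N = 1 ∧ N * M = 1 ∧
      (∀ a b, k3Form (M a) (M b) = (n : ℂ) * k3Form a b) := by
  obtain ⟨a, b, c, d, habcd⟩ := Nat.sum_four_squares n
  have hm : (a : ℚ) ^ 2 + (b : ℚ) ^ 2 + (c : ℚ) ^ 2 + (d : ℚ) ^ 2 = (n : ℚ) := by exact_mod_cast habcd
  have hn0 : (n : ℚ) ≠ 0 := by exact_mod_cast hn.ne'
  set A : Matrix K3Index K3Index ℚ := (4 : ℚ)⁻¹ • AA[(a : ℚ), (b : ℚ), (c : ℚ), (d : ℚ), (n : ℚ)] with hA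
  set B : Matrix K3Index K3Index ℚ := (4 * (n : ℚ))⁻¹ • BB[(a : ℚ), (b : ℚ), (c : ℚ), (d : ℚ), (n : ℚ)]
    with hB
  have hAB : A * B = 1 := by
    rw [hA, hB, smul_mul_assoc, mul_smul_comm, aa_mul_bb_eq _ _ _ _ _ hm, smul_smul, smul_smul]
    have h : (4 : ℚ)⁻¹ * (4 * (n : ℚ))⁻¹ * (16 * n) = 1 :=
      calc (4 : ℚ)⁻¹ * (4 * (n : ℚ))⁻¹ * (16 * n)
          = ((4 : ℚ)⁻¹ * 4) * ((4 * (n : ℚ))⁻¹ * (4 * n)) := by ring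
        _ = 1 := by
          rw [inv_mul_cancel₀ (by norm_num : (4 : ℚ) ≠ 0),
            inv_mul_cancel₀ (mul_ne_zero (by norm_num) hn0), one_mul]
    rw [h, one_smul]
  have hBA : B * A = 1 := by
    rw [hA, hB, smul_mul_assoc, mul_smul_comm, bb_mul_aa_eq _ _ _ _ _ hm, smul_smul, smul_smul]
    have h : (4 * (n : ℚ))⁻¹ * (4 : ℚ)⁻¹ * (16 * n) = 1 :=
      calc (4 * (n : ℚ))⁻¹ * (4 : ℚ)⁻¹ * (16 * n)
          = ((4 : ℚ)⁻¹ * 4) * ((4 * (n : ℚ))⁻¹ * (4 * n)) := by ring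
        _ = 1 := by
          rw [inv_mul_cancel₀ (by norm_num : (4 : ℚ) ≠ 0),
            inv_mul_cancel₀ (mul_ne_zero (by norm_num) hn0), one_mul]
    rw [h, one_smul]
  have hAconj : Aᵀ * k3Gram.map (Int.cast : ℤ → ℚ) * A = (n : ℚ) • k3Gram.map (Int.cast : ℤ → ℚ) := by
    rw [hA, Matrix.transpose_smul, smul_mul_assoc, smul_mul_assoc, mul_smul_comm,
      aa_conj_eq _ _ _ _ _ hm, smul_smul, smul_smul]
    congr 1
    norm_num
    ring
  refine ⟨Matrix.toLin' (A.map (Rat.castHom ℂ)), Matrix.toLin' (B.map (Rat.castHom ℂ)),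
    fun v => ⟨A *ᵥ fun i => (v i : ℚ), ?_⟩, fun v => ⟨B *ᵥ fun i => (v i : ℚ), ?_⟩, ?_, ?_, ?_⟩
  · rw [Matrix.toLin'_apply, intCast_eq_ratCast_intCast, ratCast_map_mulVec]
  · rw [Matrix.toLin'_apply, intCast_eq_ratCast_intCast, ratCast_map_mulVec]
  · rw [Module.End.mul_eq_comp, ← Matrix.toLin'_mul, ← Matrix.map_mul, hAB,
      Matrix.map_one _ (map_zero _) (map_one _), Matrix.toLin'_one, Module.End.one_eq_id]
  · rw [Module.End.mul_eq_comp, ← Matrix.toLin'_mul, ← Matrix.map_mul, hBA,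
      Matrix.map_one _ (map_zero _) (map_one _), Matrix.toLin'_one, Module.End.one_eq_id]
  · intro u w
    have hG : k3Gram.map (Int.cast : ℤ → ℂ) = (k3Gram.map (Int.cast : ℤ → ℚ)).map (Rat.castHom ℂ) := by
      rw [Matrix.map_map]
      exact Matrix.ext fun i j => by simp
    have hC : (A.map (Rat.castHom ℂ))ᵀ * k3Gram.map (Int.cast : ℤ → ℂ) * A.map (Rat.castHom ℂ) =
        (n : ℂ) • k3Gram.map (Int.cast : ℤ → ℂ) := by
      rw [hG, ← Matrix.transpose_map, ← Matrix.map_mul, ← Matrix.map_mul, hAconj,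
        Matrix.map_smul' _ _ _ (map_mul (Rat.castHom ℂ)), map_natCast]
    rw [Matrix.toLin'_apply, Matrix.toLin'_apply, k3Form_eq_dotProduct, k3Form_eq_dotProduct,
      ← Matrix.vecMul_transpose (A.map _) u]
    simp only [Matrix.dotProduct_mulVec, Matrix.vecMul_vecMul, hC, Matrix.vecMul_smul,
      smul_dotProduct, smul_eq_mul]

end Summit.HodgeConjecture.HodgeConjecture.Theorems.NikulinTwinTransport

end
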